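import Summits.HodgeConjecture.CorCM.OcticCMFieldAutomorphismsNondegenerate
import Summits.HodgeConjecture.CorCM.GaloisOcticSimpleCMFourfolds
import Summits.HodgeConjecture.HodgeConjecture.Theorems.Ring2ClassTargets
import Literature.AlgebraicGeometry.Pohlmann1968.SimpleCMAbelianVarietyPowersDivisorGenerated
import Literature.AlgebraicGeometry.ComplexMultiplication.PrincipalModelOfCMOrder
import Literature.NumberTheory.ComplexMultiplication.CMTypeDictionary
import Literature.AlgebraicGeometry.Motives.AbelianVarietySimpleOfIsogeny
import HarnessLib

/-!
# Simple abelian fourfolds with an action of an octic CM field having more than two automorphisms: the Hodge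
# conjecture for everything isogenous to a power — intrinsic (binder-free) forms and the class-target display

COR-CM (cell `pub-hodgecm2`), binder seat b04 (gen 13), count-neutral claim GALOIS-OCTIC, part IV (the binders);
capstone of parts I–III (`CorCM/GaloisOcticStabiliserLemma`, `GaloisOcticSimpleCMFourfolds`,
`OcticCMFieldAutomorphismsFibres`, `OcticCMFieldAutomorphismsNondegenerate`).  KERNEL ONLY: theorems, no definition,
no named fact, no `sorry`.  `HC_CM` is NOT used and NOT claimed: every statement is the Hodge conjecture for a NAMED
SUB-CLASS of complex abelian varieties, UNCONDITIONAL (axioms standard).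

The type-level theorems of parts II/III take a realisation `(A, ι, θ)` of a CM type as data.  Here they are read on a
SIMPLE complex abelian fourfold `X` with a ring homomorphism `φ : F →+* End⁰(X)` from an octic CM field `F` — via
Shimura's principal model in the isogeny class (`exists_principal_pair`, §7.1 Prop. 7) realising the CM type of the
pair (`isCMTypeRealisation_cmTypeOfPair`, §5.2), simplicity along isogenies, and the isogeny invariance of `B = D` /
of the Hodge conjecture (van Geemen 3.7):

* `isDivisorGenerated_of_isIsogenous_powSucc_of_ringHom_of_ne_complexConj` /
  **`hodgeConjectureFor_of_isIsogenous_powSucc_of_ringHom_of_ne_complexConj`** — if `F` (octic, CM) has an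
  automorphism `t ∉ {1, c}`, then for every SIMPLE abelian fourfold `X` with `φ : F →+* End⁰(X)`, every complex abelian
  variety isogenous to a power `X^{N+1}` is divisor-generated and satisfies the Hodge conjecture;
* the same under `2 < |Aut(F/ℚ)|` (`…_of_two_lt_card`) and for `F/ℚ` GALOIS (`…_of_isGalois`);
* the class-target displays (`Ring2.ClassTargets.HCOnClass`, the vocabulary of the `g ≤ 7` atlas):
  **`hcOnClass_isIsogenous_powSucc_simpleFourfold_octicCM_two_lt_card`** — the Hodge conjecture on the class of
  complex abelian varieties isogenous to a power of a simple abelian fourfold carrying an action of an octic CM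
  field with more than two automorphisms (dimensions `4k`); and its Galois sub-class
  `hcOnClass_isIsogenous_powSucc_simpleFourfold_galoisOcticCM`.

Print: the Galois / automorphism hypothesis is Dodson 1984 §3.3.2 (⟹) (a degenerate simple CM fourfold has
`Aut(K/ℚ) = {1, c}`), proved classification-free in part III; Hazama–Murty (`B = D` on all powers of a nondegenerate
CM abelian variety), Lefschetz (1,1).

## References
* [Dodson1984] B. Dodson, Trans. AMS 283 (1984), §3.3.2 Theorem (p. 16).
* [Shimura1998] G. Shimura, *Abelian Varieties with Complex Multiplication and Modular Functions*, §5.2, §7.1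
  Prop. 7, §8.2 Prop. 26.
* [vanGeemen1994HodgeAV] B. van Geemen, LNM 1594 (1994), Lemma 3.7.
* [Gordon1999HodgeAVSurvey] B. B. Gordon, Thm. 6.4, 5.13.
* [Deligne2000] P. Deligne, *The Hodge conjecture* (Clay, 2000), §1.
-/

noncomputable section

open CategoryTheory CategoryTheory.Limits NumberField

namespace Summit.HodgeConjecture.CorCM.GaloisOctic

open Literature.NumberTheory.ComplexMultiplication
open Literature.AlgebraicGeometry Literature.AlgebraicGeometry.Motives Literature.AlgebraicGeometry.HodgeTheory
open Literature.AlgebraicGeometry.Motives.AbelianVariety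
open Literature.AlgebraicGeometry.ComplexMultiplication
open Literature.AlgebraicGeometry.Pohlmann1968
open Summit.HodgeConjecture.HodgeConjecture.Ring2.ClassTargets

variable {F : Type} [Field F] [NumberField F] [IsCMField F]

/-! ### §1 From `φ : F →+* End⁰(X)` to a nondegenerate realisation in the isogeny class -/

/-- **Principal model with a nondegenerate type.**  For a SIMPLE abelian fourfold `X` with `φ : F →+* End⁰(X)`, `F`
an octic CM field with an automorphism `t ∉ {1, c}`: there is `X′` isogenous to `X` realising a NONDEGENERATE CM
type of `F` (Shimura's principal pair + part III). [cite: Shimura1998, §7.1 Prop. 7 and §5.2]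
[cite: Dodson1984, §3.3.2 Theorem (p. 16)] -/
theorem exists_isIsogenous_realisation_isNondegenerate_of_ne_complexConj (hF : Module.finrank ℚ F = 8)
    (t : F ≃ₐ[ℚ] F) (ht1 : t ≠ 1) (htc : t ≠ (IsCMField.complexConj F).restrictScalars ℚ)
    {X : AbelianVariety ℂ} (hXs : X.IsSimple) (hX4 : X.dim = 4) (φ : F →+* X.endAlgebra) :
    ∃ (X' : AbelianVariety ℂ) (Φ : CMType F) (ι : 𝓞 F →+* End X')
      (θ : F →+* Module.End ℂ (complexBetti X'.X 1)),
      IsIsogenous X X' ∧ IsCMTypeRealisation Φ X' ι θ ∧ IsNondegenerate Φ := by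
  obtain ⟨X', φ', ι', hφι, f, hf⟩ := exists_principal_pair φ
  have hdim' : Module.finrank ℚ F = 2 * X'.dim := by rw [hF, ← dim_eq_of_isIsogeny hf, hX4]
  have hreal := isCMTypeRealisation_cmTypeOfPair φ' hdim' ι' hφι
  obtain ⟨s₀⟩ := (inferInstance : Nonempty (F →+* ℂ))
  exact ⟨X', _, ι', _, ⟨f, hf⟩, hreal, isNondegenerate_of_isPrimitive_of_ne_complexConj hF s₀
    ((isSimple_iff_isPrimitive hreal s₀).1 (hXs.of_isIsogeny hf)) t ht1 htc⟩

/-! ### §2 `B = D` and the Hodge conjecture for everything isogenous to a power of `X` -/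

/-- **`B = D` for every complex abelian variety isogenous to a power `X^{N+1}`** of a simple abelian fourfold `X`
with `φ : F →+* End⁰(X)`, `F` octic CM with an automorphism `t ∉ {1, c}` (Hazama–Murty via nondegeneracy;
isogeny invariance of `B = D`). [cite: Gordon1999HodgeAVSurvey, Thm. 6.4 and §9.3] [cite: vanGeemen1994HodgeAV, §3.6] -/
theorem isDivisorGenerated_of_isIsogenous_powSucc_of_ringHom_of_ne_complexConj (hF : Module.finrank ℚ F = 8)
    (t : F ≃ₐ[ℚ] F) (ht1 : t ≠ 1) (htc : t ≠ (IsCMField.complexConj F).restrictScalars ℚ)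
    {X : AbelianVariety ℂ} (hXs : X.IsSimple) (hX4 : X.dim = 4) (φ : F →+* X.endAlgebra)
    {B : AbelianVariety ℂ} {N : ℕ} (h : IsIsogenous B (X.powSucc N)) : IsDivisorGenerated B := by
  obtain ⟨X', Φ, ι, θ, hXX', hreal, hΦ⟩ :=
    exists_isIsogenous_realisation_isNondegenerate_of_ne_complexConj hF t ht1 htc hXs hX4 φ
  exact hΦ.isDivisorGenerated_of_isIsogenous_powSucc hreal (h.trans (isIsogenous_powSucc hXX' N))

/-- **The Hodge conjecture for every complex abelian variety isogenous to a power `X^{N+1}` of a SIMPLE abelian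
fourfold `X` carrying an action `φ : F →+* End⁰(X)` of an octic CM field `F` with an automorphism other than `1` and
complex conjugation** — UNCONDITIONALLY. [cite: Dodson1984, §3.3.2 Theorem (p. 16)]
[cite: Gordon1999HodgeAVSurvey, Thm. 6.4] [cite: vanGeemen1994HodgeAV, Lemma 3.7] [cite: Deligne2000, §1] -/
theorem hodgeConjectureFor_of_isIsogenous_powSucc_of_ringHom_of_ne_complexConj (hF : Module.finrank ℚ F = 8)
    (t : F ≃ₐ[ℚ] F) (ht1 : t ≠ 1) (htc : t ≠ (IsCMField.complexConj F).restrictScalars ℚ)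
    {X : AbelianVariety ℂ} (hXs : X.IsSimple) (hX4 : X.dim = 4) (φ : F →+* X.endAlgebra)
    {B : AbelianVariety ℂ} {N : ℕ} (h : IsIsogenous B (X.powSucc N)) : HodgeConjectureFor B.dim B.X :=
  hodgeConjectureFor_of_isDivisorGenerated _
    (isDivisorGenerated_of_isIsogenous_powSucc_of_ringHom_of_ne_complexConj hF t ht1 htc hXs hX4 φ h)

/-- The same under the automorphism COUNT `2 < |Aut(F/ℚ)|` (some `t ∉ {1, c}` then exists).
[cite: Dodson1984, §3.3.2 Theorem (p. 16)] [cite: Deligne2000, §1] -/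
theorem hodgeConjectureFor_of_isIsogenous_powSucc_of_ringHom_of_two_lt_card (hF : Module.finrank ℚ F = 8)
    (hcard : 2 < Nat.card (F ≃ₐ[ℚ] F)) {X : AbelianVariety ℂ} (hXs : X.IsSimple) (hX4 : X.dim = 4)
    (φ : F →+* X.endAlgebra) {B : AbelianVariety ℂ} {N : ℕ} (h : IsIsogenous B (X.powSucc N)) :
    HodgeConjectureFor B.dim B.X := by
  -- some automorphism is neither `1` nor `c`: otherwise `Aut(F/ℚ) ⊆ {1, c}` has at most two elements
  set c : F ≃ₐ[ℚ] F := (IsCMField.complexConj F).restrictScalars ℚ with hc_def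
  by_cases hex : ∃ t : F ≃ₐ[ℚ] F, t ≠ 1 ∧ t ≠ c
  · obtain ⟨t, ht1, htc⟩ := hex
    exact hodgeConjectureFor_of_isIsogenous_powSucc_of_ringHom_of_ne_complexConj hF t ht1 htc hXs hX4 φ h
  · exfalso
    push Not at hex
    have hsub : (Set.univ : Set (F ≃ₐ[ℚ] F)) ⊆ {1, c} := by
      intro a _
      by_cases ha : a = 1
      · exact Or.inl ha
      · exact Or.inr (hex a ha)
    have hle : (Set.univ : Set (F ≃ₐ[ℚ] F)).ncard ≤ ({1, c} : Set (F ≃ₐ[ℚ] F)).ncard :=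
      Set.ncard_le_ncard hsub (Set.toFinite _)
    rw [Set.ncard_univ] at hle
    have h2 : ({1, c} : Set (F ≃ₐ[ℚ] F)).ncard ≤ 2 :=
      (Set.ncard_insert_le 1 {c}).trans (by rw [Set.ncard_singleton])
    omega

/-- The GALOIS case: `|Aut(F/ℚ)| = 8 > 2` (part II's class, now with the isotypic cells over it).
[cite: Dodson1984, §3.3.2 Theorem (p. 16)] [cite: Deligne2000, §1] -/
theorem hodgeConjectureFor_of_isIsogenous_powSucc_of_ringHom_of_isGalois [IsGalois ℚ F]
    (hF : Module.finrank ℚ F = 8) {X : AbelianVariety ℂ} (hXs : X.IsSimple) (hX4 : X.dim = 4)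
    (φ : F →+* X.endAlgebra) {B : AbelianVariety ℂ} {N : ℕ} (h : IsIsogenous B (X.powSucc N)) :
    HodgeConjectureFor B.dim B.X :=
  hodgeConjectureFor_of_isIsogenous_powSucc_of_ringHom_of_two_lt_card hF
    (by rw [IsGalois.card_aut_eq_finrank, hF]; norm_num) hXs hX4 φ h

/-- The variety itself (`N = 0`, `B = X`): **the Hodge conjecture for every simple abelian fourfold with an action
of an octic CM field having more than two automorphisms.** [cite: Dodson1984, §3.3.2 Theorem (p. 16)] [cite: Deligne2000, §1] -/
theorem hodgeConjectureFor_of_ringHom_of_two_lt_card (hF : Module.finrank ℚ F = 8)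
    (hcard : 2 < Nat.card (F ≃ₐ[ℚ] F)) {X : AbelianVariety ℂ} (hXs : X.IsSimple) (hX4 : X.dim = 4)
    (φ : F →+* X.endAlgebra) : HodgeConjectureFor X.dim X.X :=
  hodgeConjectureFor_of_isIsogenous_powSucc_of_ringHom_of_two_lt_card hF hcard hXs hX4 φ (N := 0)
    (IsIsogenous.refl X)

/-! ### §3 Class-target displays (`HCOnClass`) -/

/-- **HC on the class «isogenous to a power of a simple abelian fourfold with an action of an octic CM field having
more than two automorphisms»** (dimensions `4(N+1)`), UNCONDITIONAL — a closed class target in the vocabulary of the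
`g ≤ 7` atlas. [cite: Dodson1984, §3.3.2 Theorem (p. 16)] [cite: Deligne2000, §1] -/
theorem hcOnClass_isIsogenous_powSucc_simpleFourfold_octicCM_two_lt_card :
    HCOnClass fun B ↦ ∃ (X : AbelianVariety ℂ) (N : ℕ) (F : Type) (_ : Field F) (_ : NumberField F)
      (_ : IsCMField F), X.IsSimple ∧ X.dim = 4 ∧ Module.finrank ℚ F = 8 ∧ 2 < Nat.card (F ≃ₐ[ℚ] F) ∧
      Nonempty (F →+* X.endAlgebra) ∧ IsIsogenous B (X.powSucc N) := by
  rintro B ⟨X, N, F, _, _, _, hXs, hX4, hF, hcard, ⟨φ⟩, h⟩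
  exact hodgeConjectureFor_of_isIsogenous_powSucc_of_ringHom_of_two_lt_card hF hcard hXs hX4 φ h

/-- **HC on the sub-class «isogenous to a power of a simple abelian fourfold with an action of a GALOIS octic CM
field»**, UNCONDITIONAL. [cite: Dodson1984, §3.3.2 Theorem (p. 16)] [cite: Deligne2000, §1] -/
theorem hcOnClass_isIsogenous_powSucc_simpleFourfold_galoisOcticCM :
    HCOnClass fun B ↦ ∃ (X : AbelianVariety ℂ) (N : ℕ) (F : Type) (_ : Field F) (_ : NumberField F)
      (_ : IsCMField F) (_ : IsGalois ℚ F), X.IsSimple ∧ X.dim = 4 ∧ Module.finrank ℚ F = 8 ∧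
      Nonempty (F →+* X.endAlgebra) ∧ IsIsogenous B (X.powSucc N) := by
  rintro B ⟨X, N, F, _, _, _, _, hXs, hX4, hF, ⟨φ⟩, h⟩
  exact hodgeConjectureFor_of_isIsogenous_powSucc_of_ringHom_of_isGalois hF hXs hX4 φ h

end Summit.HodgeConjecture.CorCM.GaloisOctic

end
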